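import Mathlib.Topology.Instances.AddCircle.Defs
import Mathlib.Data.ZMod.QuotientGroup
import Mathlib.Data.Set.Card
import Mathlib.GroupTheory.Torsion
import Mathlib.GroupTheory.QuotientGroup.Finite
import Mathlib.Algebra.Module.Torsion.Basic
import Mathlib.LinearAlgebra.FreeModule.ModN
import Mathlib.FieldTheory.Finiteness
import Mathlib.Algebra.Field.ZMod
import HarnessLib

/-!
# Alternating pairings on abelian `p`-groups: the `p`-rank is even

Pure algebra behind the comparison of the two forms of the `p`-parity theorem for elliptic curves
(Dokchitser–Dokchitser 2010, Thm. 1.4, in the `p^∞`-Selmer corank form, and Bhargava–Shankar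
2015, Thm. 42 = Bhargava–Skinner–Zhang, Thm. 15, in the `p`-Selmer rank form): by the Cassels–Tate
pairing, `Ш(E/ℚ)[p^∞] ≅ (ℚ_p/ℤ_p)^δ ⊕ F` with `F` a finite abelian `p`-group carrying a
non-degenerate *alternating* `ℚ/ℤ`-valued pairing, whence `dim_{𝔽_p} F[p] = dim_{𝔽_p} F/pF` is
even (T. Dokchitser, *Notes on the parity conjecture* (2013), §2, first display: "`Ш[p^∞] ≅
(ℚ_p/ℤ_p)^{δ_p} ×` (finite `p`-group of square order)"). This file proves the group theory, with
no reference to elliptic curves: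

* `Literature.Algebra.Module.mem_zmultiples_of_addOrderOf_eq` — in `ℚ/ℤ = AddCircle (1 : ℚ)` an
  element of order `N` generates the `N`-torsion.
* `Literature.Algebra.Module.exists_natCard_eq_pow_two_mul` — a finite abelian `p`-group `Q` with a
  non-degenerate alternating pairing `Q × Q → ℚ/ℤ` has order `p ^ (2e)` (symplectic reduction: for
  `x` of maximal order `p ^ k` and `y` with `⟨x, y⟩` of order `p ^ k`, the map
  `q ↦ (⟨q, y⟩, -⟨q, x⟩)` has kernel `{x, y}^⊥` and image `ℤb × ℤb`, `b = ⟨x, y⟩`).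
* `Literature.Algebra.Module.exists_natCard_torsionBy_eq_pow_two_mul` — hence `#Q[p] = p ^ (2m)`
  (apply the previous result to `Q` and to `pQ` with the pairing `⟨pu, pv⟩₁ = ⟨u, pv⟩`).
* `Literature.Algebra.Module.exists_map_nsmul_succ_eq`,
  `Literature.Algebra.Module.exists_pDivisible_nsmul_map` — for a `p`-primary group `T` with
  finite `p`-torsion the chain `p^k T` stabilises at a `p`-divisible subgroup `D = p^K T` (the
  elementary shadow of `T ≅ (ℚ_p/ℤ_p)^δ ⊕ (finite)`).
* `Literature.Algebra.Module.exists_natCard_modN_primaryComponent_eq_pow_two_mul` — **main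
  result**: if `A` is a torsion abelian group with finite `p`-torsion and `B : A × A → ℚ/ℤ` is a
  bi-additive alternating pairing whose kernel is exactly the subgroup of divisible elements of `A`
  (the printed properties of the Cassels–Tate pairing on `A = Ш(E/K)`, Milne, *ADT*, I.6.13(a)),
  then for `T = A[p^∞]` the group `T/pT` has order `p ^ (2m)`; in particular
  `dim_{𝔽_p} T/pT` is even (`even_finrank_modN_primaryComponent`).
* Two counting lemmas used downstream: `natCard_torsionBy_addSubgroupOf`-type identities
  `#(H[n]) = #(H ⊓ A[n])` and `#(A[p^∞][p]) = #A[p]`.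

Everything is proved; there are no definitions and no named facts in this file.

## References

* T. Dokchitser, *Notes on the parity conjecture*, in: Elliptic Curves, Hilbert Modular Forms and
  Galois Deformations, Birkhäuser (2013) = arXiv:1009.5389, §2 (bib `Dokchitser2013ParityNotes`).
* J. S. Milne, *Arithmetic Duality Theorems*, 2nd ed., I.6.13(a), I.6.26 (Cassels–Tate pairing:
  alternating, kernel the divisible subgroup).
* L. Fuchs, *Infinite Abelian Groups* I, §20–§23 (divisible subgroups, `p`-basic facts). [folklore]
-/

noncomputable section

open scoped AddSubgroup

universe u

namespace Literature.Algebra.Module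

/-! ### Skew-symmetry of alternating pairings; the `N`-torsion of `ℚ/ℤ` -/

/-- An alternating bi-additive pairing is skew-symmetric: `B y x = -B x y` (expand
`B (x + y) (x + y) = 0`). [folklore] -/
theorem apply_apply_eq_neg {Q Z : Type*} [AddCommGroup Q] [AddCommGroup Z] (B : Q →+ Q →+ Z)
    (halt : ∀ x, B x x = 0) (x y : Q) : B y x = -B x y := by
  have h : B x y + B y x = 0 := by
    have h' := halt (x + y)
    simp only [map_add, AddMonoidHom.add_apply, halt, zero_add, add_zero] at h'
    first
    | exact h'
    | (rw [add_comm] at h'; exact h')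
  exact eq_neg_of_add_eq_zero_right h

/-- In `ℚ/ℤ = AddCircle (1 : ℚ)` an element `b` of order `N > 0` generates the whole `N`-torsion:
if `N • z = 0` then `z ∈ ℤb` (the `N`-torsion of `ℚ/ℤ` has at most `N` elements, Mathlib's
`AddCircle.card_torsion_le_of_isSMulRegular`, and `ℤb` has exactly `N`). [folklore] -/
theorem mem_zmultiples_of_addOrderOf_eq {N : ℕ} (hN : 0 < N) {b z : AddCircle (1 : ℚ)}
    (hb : addOrderOf b = N) (hz : N • z = 0) : z ∈ AddSubgroup.zmultiples b := by
  set S : Set (AddCircle (1 : ℚ)) := {x | N • x = 0} with hS_def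
  have hreg : IsSMulRegular ℚ N :=
    IsSMulRegular.of_right_eq_zero_of_smul fun (q : ℚ) hq ↦ by
      rcases (mul_eq_zero.mp ((nsmul_eq_mul N q) ▸ hq)) with h | h
      · exact absurd h (by exact_mod_cast hN.ne')
      · exact h
  have hScard : S.encard ≤ N := AddCircle.card_torsion_le_of_isSMulRegular 1 N hN.ne' hreg
  have hfin : IsOfFinAddOrder b := addOrderOf_pos_iff.mp (hb ▸ hN)
  have hsub : (AddSubgroup.zmultiples b : Set (AddCircle (1 : ℚ))) ⊆ S := by
    rintro _ ⟨k, rfl⟩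
    show N • (k • b) = 0
    rw [← hb, smul_comm, addOrderOf_nsmul_eq_zero, smul_zero]
  have hZcard : (AddSubgroup.zmultiples b : Set (AddCircle (1 : ℚ))).encard = N := by
    rw [← (hfin.finite_zmultiples).cast_ncard_eq, ← Nat.card_coe_set_eq]
    have h : Nat.card (AddSubgroup.zmultiples b : Set (AddCircle (1 : ℚ))) = N := by
      rw [← hb, ← Nat.card_zmultiples b]
      rfl
    exact_mod_cast h
  have heq : (AddSubgroup.zmultiples b : Set (AddCircle (1 : ℚ))) = S :=
    hfin.finite_zmultiples.eq_of_subset_of_encard_le hsub (hScard.trans hZcard.symm.le)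
  have hzS : z ∈ S := hz
  rw [← heq] at hzS
  exact hzS

/-! ### Finite abelian `p`-groups with a non-degenerate alternating pairing -/

section Symplectic

variable {p : ℕ} [hp : Fact p.Prime]

/-- **A finite abelian `p`-group with a non-degenerate alternating `ℚ/ℤ`-valued pairing has order
`p ^ (2e)`** (induction on the order; universe-quantified form). For `x` of maximal order `p ^ k`
there is `y` with `b = B x y` of order exactly `p ^ k`; the homomorphism `q ↦ (B q y, -B q x)` has
kernel `P = {x, y}^⊥` and image `ℤb × ℤb` (of order `p ^ 2k`), and the restriction of `B` to `P`
is again non-degenerate. Classical (symplectic bases of finite abelian groups with an alternating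
form; cf. Poonen–Stoll 1999, §6, and the use in Dokchitser, *Notes on the parity conjecture*, §2).
[folklore] -/
theorem exists_natCard_eq_pow_two_mul_aux (N : ℕ) :
    ∀ (Q : Type u) [AddCommGroup Q] [Finite Q], Nat.card Q = N →
      (∀ q : Q, ∃ n : ℕ, p ^ n • q = 0) →
      ∀ B : Q →+ Q →+ AddCircle (1 : ℚ), (∀ x, B x x = 0) →
        (∀ x, (∀ y, B x y = 0) → x = 0) → ∃ e : ℕ, Nat.card Q = p ^ (2 * e) := by
  induction N using Nat.strong_induction_on with
  | _ N ih =>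
  intro Q _ _ hN hQ B halt hnd
  rcases subsingleton_or_nontrivial Q with hsub | hnt
  · exact ⟨0, by rw [mul_zero, pow_zero]; exact Nat.card_of_subsingleton (0 : Q)⟩
  -- orders are powers of `p`
  have hord : ∀ q : Q, ∃ j : ℕ, addOrderOf q = p ^ j := fun q ↦ by
    obtain ⟨n, hn⟩ := hQ q
    obtain ⟨j, -, hj⟩ := (Nat.dvd_prime_pow hp.out).1 (addOrderOf_dvd_of_nsmul_eq_zero hn)
    exact ⟨j, hj⟩
  -- an element `x` of maximal order `p ^ k`, `k ≥ 1`
  obtain ⟨x, hxmax⟩ := Finite.exists_max (fun q : Q ↦ addOrderOf q)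
  obtain ⟨k, hk⟩ := hord x
  have hk1 : 1 ≤ k := by
    obtain ⟨q, hq⟩ := exists_ne (0 : Q)
    by_contra hk0
    have hk0' : k = 0 := by omega
    have h1 : addOrderOf q ≤ 1 := by simpa [hk, hk0'] using hxmax q
    have h2 : 0 < addOrderOf q := addOrderOf_pos q
    have h3 : addOrderOf q = 1 := by omega
    exact hq (AddMonoid.addOrderOf_eq_one_iff.mp h3)
  have hxk : p ^ (k - 1) • x ≠ 0 := by
    intro h0
    have hdvd : p ^ k ∣ p ^ (k - 1) := hk ▸ addOrderOf_dvd_of_nsmul_eq_zero h0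
    have := (Nat.pow_dvd_pow_iff_le_right hp.out.one_lt).1 hdvd
    omega
  obtain ⟨y, hy⟩ : ∃ y, B (p ^ (k - 1) • x) y ≠ 0 := by
    by_contra h
    push Not at h
    exact hxk (hnd _ h)
  set b : AddCircle (1 : ℚ) := B x y with hb_def
  have hbk1 : p ^ (k - 1) • b ≠ 0 := by
    rwa [hb_def, ← AddMonoidHom.nsmul_apply, ← map_nsmul]
  have hpky : p ^ k • y = 0 := by
    obtain ⟨j, hj⟩ := hord y
    have hjk : p ^ j ≤ p ^ k := by rw [← hj, ← hk]; exact hxmax y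
    have hjk' : j ≤ k := (Nat.pow_le_pow_iff_right hp.out.one_lt).1 hjk
    obtain ⟨i, rfl⟩ := Nat.exists_eq_add_of_le hjk'
    rw [pow_add, mul_comm, mul_smul, ← hj, addOrderOf_nsmul_eq_zero, smul_zero]
  have hpkb : p ^ k • b = 0 := by
    rw [hb_def, ← AddMonoidHom.nsmul_apply, ← map_nsmul, ← hk, addOrderOf_nsmul_eq_zero,
      map_zero, AddMonoidHom.zero_apply]
  have hbord : addOrderOf b = p ^ k := by
    obtain ⟨j, hjle, hj⟩ := (Nat.dvd_prime_pow hp.out).1 (addOrderOf_dvd_of_nsmul_eq_zero hpkb)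
    rw [hj]
    rcases hjle.lt_or_eq with hlt | heq
    · exfalso
      apply hbk1
      obtain ⟨i, hi⟩ := Nat.exists_eq_add_of_le (show j ≤ k - 1 by omega)
      rw [hi, pow_add, mul_comm, mul_smul, ← hj, addOrderOf_nsmul_eq_zero, smul_zero]
    · rw [heq]
  have hskew := apply_apply_eq_neg B halt
  -- the projection `Ψ q = (B q y, -B q x)`
  set Ψ : Q →+ AddCircle (1 : ℚ) × AddCircle (1 : ℚ) := (B.flip y).prod (-(B.flip x))
    with hΨ_def
  have hΨ_apply : ∀ q, Ψ q = (B q y, -B q x) := fun q ↦ rfl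
  set P : AddSubgroup Q := Ψ.ker with hP_def
  have hmemP : ∀ q, q ∈ P ↔ B q y = 0 ∧ B q x = 0 := fun q ↦ by
    rw [hP_def, AddMonoidHom.mem_ker, hΨ_apply, Prod.mk_eq_zero, neg_eq_zero]
  set S : AddSubgroup (AddCircle (1 : ℚ)) := AddSubgroup.zmultiples b with hS_def
  have hp0 : 0 < p ^ k := pow_pos hp.out.pos k
  have hmemS : ∀ z : AddCircle (1 : ℚ), p ^ k • z = 0 → z ∈ S := fun z hz ↦
    mem_zmultiples_of_addOrderOf_eq hp0 hbord hz
  have hrange : Ψ.range = S.prod S := by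
    apply le_antisymm
    · rintro _ ⟨q, rfl⟩
      rw [hΨ_apply]
      refine AddSubgroup.mem_prod.mpr ⟨hmemS (B q y) ?_, S.neg_mem (hmemS (B q x) ?_)⟩
      · rw [← map_nsmul, hpky, map_zero]
      · rw [← map_nsmul, ← hk, addOrderOf_nsmul_eq_zero, map_zero]
    · rintro ⟨u, v⟩ huv
      obtain ⟨hu, hv⟩ := AddSubgroup.mem_prod.mp huv
      obtain ⟨a, rfl⟩ := AddSubgroup.mem_zmultiples_iff.mp hu
      obtain ⟨c, rfl⟩ := AddSubgroup.mem_zmultiples_iff.mp hv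
      refine ⟨a • x + c • y, ?_⟩
      rw [hΨ_apply]
      simp only [map_add, map_zsmul, AddMonoidHom.add_apply, AddMonoidHom.zsmul_apply, halt,
        hskew x y, smul_zero, add_zero, zero_add, smul_neg, neg_neg, ← hb_def]
  have hScard : Nat.card S = p ^ k := by rw [hS_def, Nat.card_zmultiples, hbord]
  have hcardQ : Nat.card Q = Nat.card P * (p ^ k * p ^ k) := by
    rw [hP_def, AddSubgroup.card_eq_card_quotient_mul_card_addSubgroup Ψ.ker, mul_comm,
      Nat.card_congr (QuotientAddGroup.quotientKerEquivRange Ψ).toEquiv, hrange,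
      Nat.card_congr (AddSubgroup.prodEquiv S S).toEquiv, Nat.card_prod, hScard]
  -- every `q` is `a • x + c • y` modulo `P`
  have hdecomp : ∀ q : Q, ∃ a c : ℤ, q - (a • x + c • y) ∈ P := fun q ↦ by
    have hq : (B q y, -B q x) ∈ S.prod S := by
      rw [← hΨ_apply, ← hrange]; exact ⟨q, rfl⟩
    have hu : B q y ∈ S := (AddSubgroup.mem_prod.mp hq).1
    have hv : -B q x ∈ S := (AddSubgroup.mem_prod.mp hq).2
    obtain ⟨a, ha⟩ := AddSubgroup.mem_zmultiples_iff.mp hu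
    obtain ⟨c, hc⟩ := AddSubgroup.mem_zmultiples_iff.mp hv
    refine ⟨a, c, (hmemP _).mpr ⟨?_, ?_⟩⟩
    · have e : B (q - (a • x + c • y)) y = B q y - a • b := by
        simp only [map_sub, map_add, map_zsmul, AddMonoidHom.sub_apply, AddMonoidHom.add_apply,
          AddMonoidHom.zsmul_apply, halt, smul_zero, add_zero, ← hb_def]
      rw [e, ← ha, sub_self]
    · have e : B (q - (a • x + c • y)) x = B q x + c • b := by
        simp only [map_sub, map_add, map_zsmul, AddMonoidHom.sub_apply, AddMonoidHom.add_apply,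
          AddMonoidHom.zsmul_apply, halt, hskew x y, smul_zero, zero_add, smul_neg, ← hb_def,
          sub_neg_eq_add]
      rw [e, hc]
      exact add_neg_cancel _
  -- the restriction of `B` to `P` is alternating and non-degenerate; `P` is a smaller `p`-group
  set BP : P →+ P →+ AddCircle (1 : ℚ) := ((B.comp P.subtype).flip.comp P.subtype).flip
    with hBP_def
  have hBP_apply : ∀ w v : P, BP w v = B w v := fun w v ↦ rfl
  have hPalt : ∀ w : P, BP w w = 0 := fun w ↦ by rw [hBP_apply]; exact halt w
  have hPnd : ∀ w : P, (∀ v : P, BP w v = 0) → w = 0 := by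
    intro w hw
    have hwx : B w x = 0 := ((hmemP w).mp w.2).2
    have hwy : B w y = 0 := ((hmemP w).mp w.2).1
    have hw' : ∀ q : Q, B w q = 0 := by
      intro q
      obtain ⟨a, c, hq⟩ := hdecomp q
      have h1 : B w (q - (a • x + c • y)) = 0 := by
        have := hw ⟨_, hq⟩
        rwa [hBP_apply] at this
      have e : B w q = B w (q - (a • x + c • y)) + (a • B w x + c • B w y) := by
        simp only [map_sub, map_add, map_zsmul]
        abel
      rw [e, h1, hwx, hwy, smul_zero, smul_zero, add_zero, zero_add]
    exact Subtype.ext (hnd w hw')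
  have hPprim : ∀ w : P, ∃ n : ℕ, p ^ n • w = 0 := fun w ↦ by
    obtain ⟨n, hn⟩ := hQ w
    exact ⟨n, Subtype.ext (by rw [AddSubgroupClass.coe_nsmul, hn, ZeroMemClass.coe_zero])⟩
  have hPcard : Nat.card P < N := by
    rw [← hN, hcardQ]
    have h1 : p ≤ p ^ k := by
      calc p = p ^ 1 := (pow_one p).symm
        _ ≤ p ^ k := Nat.pow_le_pow_right hp.out.pos hk1
    have h2 : 0 < Nat.card P := Nat.card_pos
    have h3 : 1 < p ^ k * p ^ k := by nlinarith [hp.out.two_le]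
    exact lt_mul_of_one_lt_right h2 h3
  obtain ⟨e, he⟩ := ih (Nat.card P) hPcard P rfl hPprim BP hPalt hPnd
  refine ⟨e + k, ?_⟩
  rw [hcardQ, he]
  ring

/-- **A finite abelian `p`-group with a non-degenerate alternating `ℚ/ℤ`-valued pairing has order
`p ^ (2e)` for some `e`.** [folklore] -/
theorem exists_natCard_eq_pow_two_mul {Q : Type u} [AddCommGroup Q] [Finite Q]
    (hQ : ∀ q : Q, ∃ n : ℕ, p ^ n • q = 0) (B : Q →+ Q →+ AddCircle (1 : ℚ))
    (halt : ∀ x, B x x = 0) (hnd : ∀ x, (∀ y, B x y = 0) → x = 0) :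
    ∃ e : ℕ, Nat.card Q = p ^ (2 * e) :=
  exists_natCard_eq_pow_two_mul_aux (Nat.card Q) Q rfl hQ B halt hnd

/-- **The `p`-rank of a finite abelian `p`-group with a non-degenerate alternating `ℚ/ℤ`-valued
pairing is even**: `#Q[p] = p ^ (2m)`. Apply the order statement to `Q` and to `pQ`, the latter
with the (well-defined, alternating, non-degenerate) pairing `⟨pu, pv⟩₁ = ⟨u, pv⟩`, and use
`#Q = #Q[p] · #pQ`. This is the "finite `p`-group of square order" with even `p`-rank in
`Ш[p^∞] ≅ (ℚ_p/ℤ_p)^δ × (finite)`, Dokchitser, *Notes on the parity conjecture* (2013), §2.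
[folklore] -/
theorem exists_natCard_torsionBy_eq_pow_two_mul {Q : Type u} [AddCommGroup Q] [Finite Q]
    (hQ : ∀ q : Q, ∃ n : ℕ, p ^ n • q = 0) (B : Q →+ Q →+ AddCircle (1 : ℚ))
    (halt : ∀ x, B x x = 0) (hnd : ∀ x, (∀ y, B x y = 0) → x = 0) :
    ∃ m : ℕ, Nat.card Q[(p : ℤ)] = p ^ (2 * m) := by
  obtain ⟨e, he⟩ := exists_natCard_eq_pow_two_mul hQ B halt hnd
  set φ : Q →+ Q := nsmulAddMonoidHom p with hφ_def
  set P₁ : AddSubgroup Q := φ.range with hP₁_def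
  have hlift' : ∀ u : P₁, ∃ v : Q, p • v = (u : Q) := fun u ↦ by
    obtain ⟨v, hv⟩ := AddMonoidHom.mem_range.mp u.2
    exact ⟨v, hv⟩
  choose lift hlift using hlift'
  have key : ∀ z w : Q, B z (p • w) = B (p • z) w := fun z w ↦ by
    simp only [map_nsmul, AddMonoidHom.nsmul_apply]
  have hindep : ∀ u u' : Q, p • u = p • u' → ∀ v : P₁, B u v = B u' v := by
    intro u u' huu' v
    obtain ⟨w, hw⟩ := AddMonoidHom.mem_range.mp v.2
    rw [← hw]
    change B u (p • w) = B u' (p • w)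
    rw [key, key, huu']
  set B₁ : P₁ →+ P₁ →+ AddCircle (1 : ℚ) :=
    AddMonoidHom.mk' (fun u ↦ (B (lift u)).comp P₁.subtype) (by
      intro u u'
      ext v
      simp only [AddMonoidHom.coe_comp, Function.comp_apply, AddMonoidHom.add_apply]
      rw [← AddMonoidHom.add_apply, ← map_add]
      refine hindep _ _ ?_ v
      rw [smul_add, hlift, hlift, hlift, AddSubgroup.coe_add]) with hB₁_def
  have hB₁_apply : ∀ u v : P₁, B₁ u v = B (lift u) v := fun u v ↦ rfl
  have hP₁prim : ∀ u : P₁, ∃ n : ℕ, p ^ n • u = 0 := fun u ↦ by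
    obtain ⟨n, hn⟩ := hQ u
    exact ⟨n, Subtype.ext (by rw [AddSubgroupClass.coe_nsmul, hn, ZeroMemClass.coe_zero])⟩
  have hB₁alt : ∀ u : P₁, B₁ u u = 0 := fun u ↦ by
    rw [hB₁_apply, ← hlift u, map_nsmul, halt, smul_zero]
  have hB₁nd : ∀ u : P₁, (∀ v : P₁, B₁ u v = 0) → u = 0 := by
    intro u hu
    have h1 : ∀ w : Q, B (p • lift u) w = 0 := fun w ↦ by
      have h := hu ⟨φ w, ⟨w, rfl⟩⟩
      rw [hB₁_apply] at h
      rw [← key]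
      exact h
    have h2 : p • lift u = 0 := hnd _ h1
    exact Subtype.ext (by rw [← hlift u, h2, ZeroMemClass.coe_zero])
  obtain ⟨e₁, he₁⟩ := exists_natCard_eq_pow_two_mul hP₁prim B₁ hB₁alt hB₁nd
  have hker : φ.ker = Q[(p : ℤ)] := by
    ext q
    rw [AddMonoidHom.mem_ker, hφ_def, nsmulAddMonoidHom_apply, AddSubgroup.torsionBy.nsmul_iff]
  have hcard : Nat.card Q = Nat.card Q[(p : ℤ)] * Nat.card P₁ := by
    rw [← hker, AddSubgroup.card_eq_card_quotient_mul_card_addSubgroup φ.ker, mul_comm,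
      Nat.card_congr (QuotientAddGroup.quotientKerEquivRange φ).toEquiv]
  rw [he, he₁] at hcard
  have hle : 2 * e₁ ≤ 2 * e := by
    have hdvd : p ^ (2 * e₁) ∣ p ^ (2 * e) := ⟨Nat.card Q[(p : ℤ)], by rw [hcard, mul_comm]⟩
    exact (Nat.pow_dvd_pow_iff_le_right hp.out.one_lt).1 hdvd
  refine ⟨e - e₁, ?_⟩
  have hpos : 0 < p ^ (2 * e₁) := pow_pos hp.out.pos _
  have h : Nat.card Q[(p : ℤ)] * p ^ (2 * e₁) = p ^ (2 * (e - e₁)) * p ^ (2 * e₁) := by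
    rw [← hcard, ← pow_add]
    congr 1
    omega
  exact Nat.eq_of_mul_eq_mul_right hpos h

end Symplectic

/-! ### `p`-primary groups with finite `p`-torsion: the divisible part `p^K T` -/

section Primary

variable {A : Type*} [AddCommGroup A] {p : ℕ} [hp : Fact p.Prime]

/-- If `C[p]` is finite then so is every `C[p^n]` (induction along `0 → C[p] → C[p^{n+1}] → C[p^n]`,
the last map being multiplication by `p`). [folklore] -/
theorem finite_torsionBy_prime_pow (C : Type*) [AddCommGroup C] (p : ℕ) [Finite C[(p : ℤ)]]
    (n : ℕ) : Finite C[((p ^ n : ℕ) : ℤ)] := by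
  induction n with
  | zero =>
    haveI : Subsingleton C[((p ^ 0 : ℕ) : ℤ)] := ⟨fun x y ↦ Subtype.ext (by
      have hx : p ^ 0 • (x : C) = 0 := AddSubgroup.torsionBy.nsmul_iff.mp x.2
      have hy : p ^ 0 • (y : C) = 0 := AddSubgroup.torsionBy.nsmul_iff.mp y.2
      simp only [pow_zero, one_smul] at hx hy
      rw [hx, hy])⟩
    infer_instance
  | succ n ih =>
    let ψ : C[((p ^ (n + 1) : ℕ) : ℤ)] →+ C[((p ^ n : ℕ) : ℤ)] :=
      ((nsmulAddMonoidHom p).comp (C[((p ^ (n + 1) : ℕ) : ℤ)]).subtype).codRestrict _ fun x ↦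
        AddSubgroup.torsionBy.nsmul_iff.mpr (by
          change p ^ n • p • (x : C) = 0
          rw [smul_smul, ← pow_succ, ← AddSubgroupClass.coe_nsmul, AddSubgroup.torsionBy.nsmul x,
            ZeroMemClass.coe_zero])
    haveI : Finite ψ.ker := by
      refine Finite.of_injective (fun x : ψ.ker ↦ (⟨((x : C[((p ^ (n + 1) : ℕ) : ℤ)]) : C),
        AddSubgroup.torsionBy.nsmul_iff.mpr ?_⟩ : C[(p : ℤ)])) ?_
      · have hx := x.2
        rw [AddMonoidHom.mem_ker] at hx
        exact congrArg (fun z : C[((p ^ n : ℕ) : ℤ)] ↦ (z : C)) hx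
      · intro x y hxy
        exact Subtype.ext (Subtype.ext (congrArg (fun z : C[(p : ℤ)] ↦ (z : C)) hxy))
    haveI : Finite (C[((p ^ (n + 1) : ℕ) : ℤ)] ⧸ ψ.ker) :=
      Finite.of_equiv _ (QuotientAddGroup.quotientKerEquivRange ψ).symm.toEquiv
    exact Finite.of_addSubgroup_quotient ψ.ker

/-- A group of exponent dividing `p ^ K` whose `p`-torsion is finite is finite. [folklore] -/
theorem finite_of_prime_pow_nsmul_eq_zero (C : Type*) [AddCommGroup C] (p : ℕ)
    [Finite C[(p : ℤ)]] (K : ℕ) (hK : ∀ c : C, p ^ K • c = 0) : Finite C := by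
  haveI := finite_torsionBy_prime_pow C p K
  exact Finite.of_surjective (fun x : C[((p ^ K : ℕ) : ℤ)] ↦ (x : C))
    fun c ↦ ⟨⟨c, AddSubgroup.torsionBy.nsmul_iff.mpr (hK c)⟩, rfl⟩

omit hp in
/-- **Stabilisation of the chain `p^k T`.** For `T = A[p^∞]` the `p`-primary component of an
abelian group `A` with finite `p`-torsion, some `p^K T` equals `p^{K+1} T`. Proof: the socles
`p^k T ∩ A[p]` form a decreasing chain of subgroups of the finite group `A[p]`, hence are constant
from some `K` on; then every `x ∈ p^K T` lies in `p^{K+1} T`, by induction on the exponent of `x`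
(if `p^{m+1} x = 0` then `p^m x ∈ p^K T ∩ A[p] = p^{K+m+1} T ∩ A[p]`, say `p^m x = p^{K+m+1} t`,
and `x - p^{K+1} t` is killed by `p^m`). This is the elementary shadow of the structure theorem
`T ≅ (ℚ_p/ℤ_p)^δ ⊕ (finite)` for `p`-primary groups of finite `p`-rank (Fuchs, *Infinite Abelian
Groups*, §23–§25). [folklore] -/
theorem exists_map_nsmul_succ_eq [Finite A[(p : ℤ)]] :
    ∃ K : ℕ, (AddCommGroup.primaryComponent A p).map (nsmulAddMonoidHom (p ^ (K + 1))) =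
      (AddCommGroup.primaryComponent A p).map (nsmulAddMonoidHom (p ^ K)) := by
  set T := AddCommGroup.primaryComponent A p with hT_def
  set D : ℕ → AddSubgroup A := fun k ↦ T.map (nsmulAddMonoidHom (p ^ k)) with hD_def
  have hmemD : ∀ k x, x ∈ D k ↔ ∃ t ∈ T, p ^ k • t = x := fun k x ↦ by
    simp only [hD_def, AddSubgroup.mem_map, nsmulAddMonoidHom_apply]
  have hanti : ∀ k, D (k + 1) ≤ D k := fun k x hx ↦ by
    obtain ⟨t, ht, rfl⟩ := (hmemD _ _).mp hx
    refine (hmemD _ _).mpr ⟨p • t, T.nsmul_mem ht p, ?_⟩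
    rw [smul_smul, ← pow_succ]
  have hanti' : ∀ k j, k ≤ j → D j ≤ D k := fun k j hkj ↦ by
    induction j, hkj using Nat.le_induction with
    | base => exact le_rfl
    | succ j _ ih => exact (hanti j).trans ih
  set S : ℕ → AddSubgroup A := fun k ↦ D k ⊓ A[(p : ℤ)] with hS_def
  haveI hSfin : ∀ k, Finite (S k) := fun k ↦
    Finite.of_injective (AddSubgroup.inclusion (inf_le_right : S k ≤ A[(p : ℤ)]))
      (AddSubgroup.inclusion_injective _)
  obtain ⟨K, hK⟩ : ∃ K, ∀ k, Nat.card (S K) ≤ Nat.card (S k) := by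
    have hne : (Set.range fun k ↦ Nat.card (S k)).Nonempty := ⟨_, 0, rfl⟩
    obtain ⟨K, hK⟩ := Nat.sInf_mem hne
    refine ⟨K, fun k ↦ ?_⟩
    have h1 : sInf (Set.range fun k ↦ Nat.card (S k)) ≤ Nat.card (S k) := Nat.sInf_le ⟨k, rfl⟩
    have h2 : Nat.card (S K) = sInf (Set.range fun k ↦ Nat.card (S k)) := hK
    omega
  have hSeq : ∀ k, K ≤ k → S k = S K := fun k hk ↦
    AddSubgroup.eq_of_le_of_card_ge (inf_le_inf_right _ (hanti' K k hk)) (hK k)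
  refine ⟨K, le_antisymm (hanti K) ?_⟩
  suffices h : ∀ m : ℕ, ∀ x ∈ D K, p ^ m • x = 0 → x ∈ D (K + 1) by
    intro x hx
    obtain ⟨t, ht, rfl⟩ := (hmemD _ _).mp hx
    obtain ⟨n, hn⟩ := (AddCommGroup.mem_primaryComponent).mp ht
    exact h n _ hx (by rw [smul_smul, mul_comm, ← smul_smul, hn, smul_zero])
  intro m
  induction m with
  | zero =>
    intro x _ hx
    rw [pow_zero, one_smul] at hx
    rw [hx]
    exact zero_mem _
  | succ m ih =>
    intro x hx hpx
    have h1 : p ^ m • x ∈ S (K + (m + 1)) := by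
      rw [hSeq (K + (m + 1)) (Nat.le_add_right _ _)]
      refine AddSubgroup.mem_inf.mpr ⟨(D K).nsmul_mem hx _, ?_⟩
      rw [AddSubgroup.torsionBy.nsmul_iff, smul_smul, ← pow_succ', hpx]
    obtain ⟨t, ht, ht'⟩ := (hmemD _ _).mp (AddSubgroup.mem_inf.mp h1).1
    have hy : p ^ (K + 1) • t ∈ D (K + 1) := (hmemD _ _).mpr ⟨t, ht, rfl⟩
    have hy' : p ^ m • (p ^ (K + 1) • t) = p ^ m • x := by
      rw [← ht', smul_smul, ← pow_add]
      congr 1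
      ring
    have hx' : x - p ^ (K + 1) • t ∈ D (K + 1) := by
      refine ih _ ((D K).sub_mem hx (hanti K hy)) ?_
      rw [smul_sub, hy', sub_self]
    have := (D (K + 1)).add_mem hx' hy
    rwa [sub_add_cancel] at this

omit hp in
/-- The step `p^{k+1} T = p (p^k T)` of the chain. [folklore] -/
theorem map_nsmul_succ (T : AddSubgroup A) (k : ℕ) :
    T.map (nsmulAddMonoidHom (p ^ (k + 1))) =
      (T.map (nsmulAddMonoidHom (p ^ k))).map (nsmulAddMonoidHom p) := by
  rw [AddSubgroup.map_map]
  congr 1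
  ext x
  simp [smul_smul, pow_succ']

omit hp in
/-- **The `p`-divisible part of a `p`-primary group with finite `p`-torsion.** For `T = A[p^∞]`
with `A[p]` finite there is `K ≥ 1` such that `D = p^K T` is `p`-divisible: every `d ∈ D` is
`p • d'` with `d' ∈ D`. (With `exists_map_nsmul_succ_eq`: `p^K T = p^{K+1} T = p (p^K T)`.)
[folklore] -/
theorem exists_pDivisible_nsmul_map [Finite A[(p : ℤ)]] :
    ∃ K : ℕ, 1 ≤ K ∧ ∀ d ∈ (AddCommGroup.primaryComponent A p).map (nsmulAddMonoidHom (p ^ K)),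
      ∃ d' ∈ (AddCommGroup.primaryComponent A p).map (nsmulAddMonoidHom (p ^ K)), p • d' = d := by
  obtain ⟨K₀, hK₀⟩ := exists_map_nsmul_succ_eq (A := A) (p := p)
  set T := AddCommGroup.primaryComponent A p with hT_def
  have hK : T.map (nsmulAddMonoidHom (p ^ (K₀ + 1 + 1))) =
      T.map (nsmulAddMonoidHom (p ^ (K₀ + 1))) := by
    rw [map_nsmul_succ T (K₀ + 1), hK₀, ← map_nsmul_succ T K₀, hK₀]
  refine ⟨K₀ + 1, Nat.le_add_left 1 K₀, fun d hd ↦ ?_⟩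
  rw [← hK, map_nsmul_succ T (K₀ + 1)] at hd
  obtain ⟨d', hd', rfl⟩ := AddSubgroup.mem_map.mp hd
  exact ⟨d', hd', rfl⟩

/-- Elements of a `p`-divisible subgroup `D` of the `p`-primary component are divisible by every
positive integer (in `A`): write `n = p^j m` with `p ∤ m`; `p^j`-divisibility is iterated
`p`-divisibility inside `D`, and `m` acts invertibly on an element of `p`-power order. [folklore] -/
theorem exists_nsmul_eq_of_pDivisible {D : AddSubgroup A}
    (hDT : D ≤ AddCommGroup.primaryComponent A p) (hdiv : ∀ d ∈ D, ∃ d' ∈ D, p • d' = d)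
    {d : A} (hd : d ∈ D) {n : ℕ} (hn : 0 < n) : ∃ y : A, n • y = d := by
  have hpow : ∀ j : ℕ, ∀ d ∈ D, ∃ d' ∈ D, p ^ j • d' = d := by
    intro j
    induction j with
    | zero => intro d hd; exact ⟨d, hd, by rw [pow_zero, one_smul]⟩
    | succ j ih =>
      intro d hd
      obtain ⟨d₁, hd₁, rfl⟩ := hdiv d hd
      obtain ⟨d₂, hd₂, rfl⟩ := ih d₁ hd₁
      exact ⟨d₂, hd₂, by rw [pow_succ', mul_smul]⟩
  obtain ⟨j, m, hm, rfl⟩ := Nat.exists_eq_pow_mul_and_not_dvd hn.ne' p hp.out.ne_one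
  obtain ⟨d', hd', rfl⟩ := hpow j d hd
  obtain ⟨a, ha⟩ := (AddCommGroup.mem_primaryComponent).mp (hDT hd')
  rcases Nat.eq_zero_or_pos a with rfl | hapos
  · rw [pow_zero, one_smul] at ha
    exact ⟨0, by rw [ha, smul_zero, smul_zero]⟩
  have hcop : Nat.Coprime m (p ^ a) :=
    (((Nat.Prime.coprime_iff_not_dvd hp.out).mpr hm).symm).pow_right a
  obtain ⟨u, -, hu⟩ := Nat.exists_mul_mod_eq_one_of_coprime hcop
    (Nat.one_lt_pow hapos.ne' hp.out.one_lt)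
  have hmu : (m * u) • d' = d' := by rw [nsmul_eq_mod_nsmul (m * u) ha, hu, one_smul]
  refine ⟨u • d', ?_⟩
  calc (p ^ j * m) • u • d' = p ^ j • ((m * u) • d') := by rw [mul_smul, mul_smul]
    _ = p ^ j • d' := by rw [hmu]

/-- In a torsion abelian group, a pairing `B t ·` with `t` of `p`-power order that vanishes on the
`p`-primary component vanishes identically: for `y` of order `p^j m`, `p ∤ m`, the element
`y_p = (m u) • y` (`m u ≡ 1 mod p^a`, `p^a t = 0`) is `p`-primary and `B t y = B t y_p`.
[folklore] -/
theorem forall_apply_eq_zero_of_forall_mem_primaryComponent (hA : AddMonoid.IsTorsion A)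
    {Z : Type*} [AddCommGroup Z] (B : A →+ A →+ Z) {t : A}
    (ht : t ∈ AddCommGroup.primaryComponent A p)
    (h : ∀ t' ∈ AddCommGroup.primaryComponent A p, B t t' = 0) (y : A) : B t y = 0 := by
  obtain ⟨a, ha⟩ := (AddCommGroup.mem_primaryComponent).mp ht
  obtain ⟨N, hN, hNy⟩ := (hA y).exists_nsmul_eq_zero
  obtain ⟨j, m, hm, rfl⟩ := Nat.exists_eq_pow_mul_and_not_dvd hN.ne' p hp.out.ne_one
  rcases Nat.eq_zero_or_pos a with rfl | hapos
  · rw [pow_zero, one_smul] at ha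
    rw [ha, map_zero, AddMonoidHom.zero_apply]
  have hcop : Nat.Coprime m (p ^ a) :=
    (((Nat.Prime.coprime_iff_not_dvd hp.out).mpr hm).symm).pow_right a
  obtain ⟨u, -, hu⟩ := Nat.exists_mul_mod_eq_one_of_coprime hcop
    (Nat.one_lt_pow hapos.ne' hp.out.one_lt)
  have hyp : (m * u) • y ∈ AddCommGroup.primaryComponent A p := by
    refine (AddCommGroup.mem_primaryComponent).mpr ⟨j, ?_⟩
    rw [smul_smul, show p ^ j * (m * u) = u * (p ^ j * m) by ring, mul_smul, hNy, smul_zero]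
  have hg : p ^ a • B t y = 0 := by
    rw [← AddMonoidHom.nsmul_apply, ← map_nsmul, ha, map_zero, AddMonoidHom.zero_apply]
  calc B t y = (m * u) • B t y := by rw [nsmul_eq_mod_nsmul (m * u) hg, hu, one_smul]
    _ = B t ((m * u) • y) := by rw [map_nsmul]
    _ = 0 := h _ hyp

/-! ### Counting lemmas -/

/-- `#(H[n]) = #(H ⊓ A[n])` for a subgroup `H ≤ A` (the same elements). [folklore] -/
theorem natCard_torsionBy_addSubgroup (H : AddSubgroup A) (n : ℤ) :
    Nat.card (H[n]) = Nat.card (H ⊓ A[n] : AddSubgroup A) := by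
  refine Nat.card_congr
    { toFun := fun x ↦ ⟨(x : H), AddSubgroup.mem_inf.mpr ⟨x.1.2, ?_⟩⟩
      invFun := fun x ↦ ⟨⟨x, (AddSubgroup.mem_inf.mp x.2).1⟩, ?_⟩
      left_inv := fun x ↦ Subtype.ext (Subtype.ext rfl)
      right_inv := fun x ↦ Subtype.ext rfl }
  · have h : n • (x : H) = 0 := (Submodule.mem_torsionBy_iff _ _).mp x.2
    have hx : n • ((x : H) : A) = 0 := by
      rw [← AddSubgroupClass.coe_zsmul, h, ZeroMemClass.coe_zero]
    exact (Submodule.mem_torsionBy_iff _ _).mpr hx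
  · have hx : n • (x : A) = 0 := (Submodule.mem_torsionBy_iff _ _).mp (AddSubgroup.mem_inf.mp x.2).2
    exact (Submodule.mem_torsionBy_iff _ _).mpr
      (Subtype.ext (by rw [AddSubgroupClass.coe_zsmul, ZeroMemClass.coe_zero]; exact hx))

omit hp in
/-- `#(A[p^∞][p]) = #A[p]`: the `p`-torsion lies in the `p`-primary component. [folklore] -/
theorem natCard_torsionBy_primaryComponent :
    Nat.card ((AddCommGroup.primaryComponent A p)[(p : ℤ)]) = Nat.card A[(p : ℤ)] := by
  rw [natCard_torsionBy_addSubgroup]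
  congr 1
  refine congrArg _ (inf_eq_right.mpr fun x hx ↦ ?_)
  exact (AddCommGroup.mem_primaryComponent).mpr
    ⟨1, by rw [pow_one]; exact AddSubgroup.torsionBy.nsmul_iff.mp hx⟩

/-! ### The main theorem -/

/-- **`T/pT` has order `p ^ (2m)` for `T = A[p^∞]`, when `A` is a torsion group with finite
`p`-torsion carrying an alternating pairing whose kernel is the subgroup of divisible elements.**
With `D = p^K T` the `p`-divisible part (`exists_pDivisible_nsmul_map`): `D` consists of divisible
elements, hence lies in the kernel of `B`; the quotient `Q = T/D` is a finite `p`-group (exponent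
`p^K`, and `Q[p]` is the image of `A[p]`) on which `B` induces a non-degenerate alternating pairing
(non-degeneracy: a `t ∈ T` pairing trivially with `T` pairs trivially with `A`, so is divisible,
so `t = p^K y` with `y ∈ T`, i.e. `t ∈ D`); hence `#Q[p] = p^(2m)`
(`exists_natCard_torsionBy_eq_pow_two_mul`), and `T/pT ≅ Q/pQ` (as `D ⊆ pT`) has
`#(Q/pQ) = #Q[p]` elements. This is the algebra of "`Ш[p^∞] ≅ (ℚ_p/ℤ_p)^{δ_p} ×` (finite `p`-group
of square order)" (Dokchitser, *Notes on the parity conjecture*, §2) from the Cassels–Tate pairing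
(Milne, *ADT*, I.6.13(a): alternating, kernel the divisible subgroup).
[cite: Dokchitser2013ParityNotes, §2 (first display)] -/
theorem exists_natCard_modN_primaryComponent_eq_pow_two_mul (hA : AddMonoid.IsTorsion A)
    [Finite A[(p : ℤ)]] (B : A →+ A →+ AddCircle (1 : ℚ)) (halt : ∀ x, B x x = 0)
    (hrad : ∀ x, (∀ y, B x y = 0) ↔ ∀ n : ℕ, 0 < n → ∃ y, n • y = x) :
    ∃ m : ℕ, Nat.card (ModN (AddCommGroup.primaryComponent A p) p) = p ^ (2 * m) := by
  obtain ⟨K, hK1, hdiv⟩ := exists_pDivisible_nsmul_map (A := A) (p := p)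
  set T : AddSubgroup A := AddCommGroup.primaryComponent A p with hT_def
  set D : AddSubgroup A := T.map (nsmulAddMonoidHom (p ^ K)) with hD_def
  have hmemD : ∀ x, x ∈ D ↔ ∃ t ∈ T, p ^ K • t = x := fun x ↦ by
    simp only [hD_def, AddSubgroup.mem_map, nsmulAddMonoidHom_apply]
  have hDT : D ≤ T := fun x hx ↦ by
    obtain ⟨t, ht, rfl⟩ := (hmemD x).mp hx
    exact T.nsmul_mem ht _
  -- `D` is in the kernel of `B`, and the kernel of `B` on `T` is `D`
  have hDrad : ∀ d ∈ D, ∀ y, B d y = 0 := fun d hd ↦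
    (hrad d).mpr fun n hn ↦ exists_nsmul_eq_of_pDivisible hDT hdiv hd hn
  have hradD : ∀ t ∈ T, (∀ t' ∈ T, B t t' = 0) → t ∈ D := by
    intro t ht h
    have h' : ∀ y, B t y = 0 := forall_apply_eq_zero_of_forall_mem_primaryComponent hA B ht h
    obtain ⟨y, hy⟩ := (hrad t).mp h' (p ^ K) (pow_pos hp.out.pos K)
    refine (hmemD t).mpr ⟨y, ?_, hy⟩
    obtain ⟨a, ha⟩ := (AddCommGroup.mem_primaryComponent).mp ht
    exact (AddCommGroup.mem_primaryComponent).mpr ⟨a + K, by rw [pow_add, mul_smul, hy, ha]⟩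
  -- the quotient `Q = T / D`
  set DT : AddSubgroup T := D.addSubgroupOf T with hDT_def
  have hmemDT : ∀ t : T, t ∈ DT ↔ (t : A) ∈ D := fun t ↦ AddSubgroup.mem_addSubgroupOf
  -- `Q[p]` is the image of `A[p]`, hence finite; `p ^ K` kills `Q`, hence `Q` is finite
  have hAp : ∀ s : A, s ∈ A[(p : ℤ)] → s ∈ T := fun s hs ↦
    (AddCommGroup.mem_primaryComponent).mpr
      ⟨1, by rw [pow_one]; exact AddSubgroup.torsionBy.nsmul_iff.mp hs⟩
  haveI : Finite (T ⧸ DT)[(p : ℤ)] := by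
    let g : A[(p : ℤ)] → (T ⧸ DT)[(p : ℤ)] := fun s ↦
      ⟨((⟨s, hAp s s.2⟩ : T) : T ⧸ DT), AddSubgroup.torsionBy.nsmul_iff.mpr (by
        rw [← QuotientAddGroup.mk_nsmul, QuotientAddGroup.eq_zero_iff, hmemDT,
          AddSubgroupClass.coe_nsmul]
        change p • (s : A) ∈ D
        rw [AddSubgroup.torsionBy.nsmul_iff.mp s.2]
        exact zero_mem _)⟩
    refine Finite.of_surjective g fun q ↦ ?_
    obtain ⟨q, hq⟩ := q
    obtain ⟨t, rfl⟩ := QuotientAddGroup.mk_surjective q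
    have hpt : p • (t : A) ∈ D := by
      have h := AddSubgroup.torsionBy.nsmul_iff.mp hq
      rw [← QuotientAddGroup.mk_nsmul, QuotientAddGroup.eq_zero_iff, hmemDT,
        AddSubgroupClass.coe_nsmul] at h
      exact h
    obtain ⟨d', hd', hd'eq⟩ := hdiv _ hpt
    have hs : (t : A) - d' ∈ A[(p : ℤ)] := by
      rw [AddSubgroup.torsionBy.nsmul_iff, smul_sub, hd'eq, sub_self]
    refine ⟨⟨(t : A) - d', hs⟩, Subtype.ext ?_⟩
    change (((⟨(t : A) - d', _⟩ : T) : T ⧸ DT)) = (t : T ⧸ DT)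
    have e : (⟨(t : A) - d', hAp _ hs⟩ : T) = t - ⟨d', hDT hd'⟩ := Subtype.ext rfl
    rw [e, QuotientAddGroup.mk_sub, sub_eq_self, QuotientAddGroup.eq_zero_iff, hmemDT]
    exact hd'
  have hQK : ∀ q : T ⧸ DT, p ^ K • q = 0 := fun q ↦ by
    obtain ⟨t, rfl⟩ := QuotientAddGroup.mk_surjective q
    rw [← QuotientAddGroup.mk_nsmul, QuotientAddGroup.eq_zero_iff, hmemDT, AddSubgroupClass.coe_nsmul]
    exact (hmemD _).mpr ⟨t, t.2, rfl⟩
  haveI : Finite (T ⧸ DT) := finite_of_prime_pow_nsmul_eq_zero (T ⧸ DT) p K hQK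
  have hQprim : ∀ q : T ⧸ DT, ∃ n : ℕ, p ^ n • q = 0 := fun q ↦ ⟨K, hQK q⟩
  -- the pairing descends to `Q`
  obtain ⟨BQ, hBQ⟩ : ∃ BQ : (T ⧸ DT) →+ (T ⧸ DT) →+ AddCircle (1 : ℚ),
      ∀ t t' : T, BQ (t : T ⧸ DT) (t' : T ⧸ DT) = B t t' := by
    let BT : T →+ T →+ AddCircle (1 : ℚ) := ((B.comp T.subtype).flip.comp T.subtype).flip
    have hBT : ∀ t t' : T, BT t t' = B t t' := fun _ _ ↦ rfl
    have hkill₂ : ∀ t : T, DT ≤ (BT t).ker := fun t d hd ↦ by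
      rw [AddMonoidHom.mem_ker, hBT, apply_apply_eq_neg B halt, neg_eq_zero]
      exact hDrad _ ((hmemDT d).mp hd) _
    let B₁ : T →+ ((T ⧸ DT) →+ AddCircle (1 : ℚ)) :=
      AddMonoidHom.mk' (fun t ↦ QuotientAddGroup.lift DT (BT t) (hkill₂ t)) (by
        intro t t'
        apply QuotientAddGroup.addMonoidHom_ext
        ext v
        simp only [AddMonoidHom.coe_comp, Function.comp_apply, QuotientAddGroup.mk'_apply,
          AddMonoidHom.add_apply, QuotientAddGroup.lift_mk, map_add])
    have hB₁ : ∀ t t' : T, B₁ t (t' : T ⧸ DT) = B t t' := fun t t' ↦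
      QuotientAddGroup.lift_mk DT (hkill₂ t) t'
    have hkill₁ : DT ≤ B₁.ker := fun d hd ↦ by
      rw [AddMonoidHom.mem_ker]
      apply QuotientAddGroup.addMonoidHom_ext
      ext v
      rw [AddMonoidHom.coe_comp, Function.comp_apply, QuotientAddGroup.mk'_apply, hB₁,
        AddMonoidHom.zero_comp, AddMonoidHom.zero_apply]
      exact hDrad _ ((hmemDT d).mp hd) _
    exact ⟨QuotientAddGroup.lift DT B₁ hkill₁, fun t t' ↦ by
      rw [QuotientAddGroup.lift_mk DT hkill₁ t, hB₁]⟩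
  have hQalt : ∀ q : T ⧸ DT, BQ q q = 0 := fun q ↦ by
    obtain ⟨t, rfl⟩ := QuotientAddGroup.mk_surjective q
    rw [hBQ]
    exact halt t
  have hQnd : ∀ q : T ⧸ DT, (∀ q', BQ q q' = 0) → q = 0 := by
    intro q hq
    obtain ⟨t, rfl⟩ := QuotientAddGroup.mk_surjective q
    rw [QuotientAddGroup.eq_zero_iff, hmemDT]
    refine hradD t t.2 fun t' ht' ↦ ?_
    have h := hq ((⟨t', ht'⟩ : T) : T ⧸ DT)
    rwa [hBQ] at h
  obtain ⟨m, hm⟩ := exists_natCard_torsionBy_eq_pow_two_mul hQprim BQ hQalt hQnd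
  refine ⟨m, ?_⟩
  rw [← hm]
  -- `#(T/pT) = #(Q/pQ) = #Q[p]`
  set M : AddSubgroup T := (LinearMap.range (LinearMap.lsmul ℤ T p)).toAddSubgroup with hM_def
  have hmemM : ∀ t : T, t ∈ M ↔ ∃ t' : T, p • t' = t := fun t ↦ by
    simp only [hM_def, Submodule.mem_toAddSubgroup, LinearMap.mem_range, LinearMap.lsmul_apply,
      Nat.cast_smul_eq_nsmul]
  have hle : DT ≤ M := fun d hd ↦ by
    obtain ⟨d', hd', hd'eq⟩ := hdiv _ ((hmemDT d).mp hd)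
    refine (hmemM d).mpr ⟨⟨d', hDT hd'⟩, Subtype.ext ?_⟩
    rw [AddSubgroupClass.coe_nsmul]
    exact hd'eq
  set ψ : (T ⧸ DT) →+ (T ⧸ DT) := nsmulAddMonoidHom p with hψ_def
  have hmap : M.map (QuotientAddGroup.mk' DT) = ψ.range := by
    ext q
    constructor
    · rintro ⟨t, ht, rfl⟩
      obtain ⟨t', rfl⟩ := (hmemM t).mp ht
      exact ⟨(t' : T ⧸ DT), by
        rw [hψ_def, nsmulAddMonoidHom_apply, QuotientAddGroup.mk'_apply, QuotientAddGroup.mk_nsmul]⟩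
    · rintro ⟨q', rfl⟩
      obtain ⟨t', rfl⟩ := QuotientAddGroup.mk_surjective q'
      exact ⟨p • t', (hmemM _).mpr ⟨t', rfl⟩, by
        rw [hψ_def, nsmulAddMonoidHom_apply, QuotientAddGroup.mk'_apply, QuotientAddGroup.mk_nsmul]⟩
  have e : ModN T p ≃+ (T ⧸ DT) ⧸ ψ.range :=
    ((QuotientAddGroup.quotientQuotientEquivQuotient DT M hle).symm).trans
      (QuotientAddGroup.quotientAddEquivOfEq hmap)
  rw [Nat.card_congr e.toEquiv]
  -- `#Q = #Q[p] · #pQ = #pQ · #(Q/pQ)`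
  have hker : ψ.ker = (T ⧸ DT)[(p : ℤ)] := by
    ext q
    rw [AddMonoidHom.mem_ker, hψ_def, nsmulAddMonoidHom_apply, AddSubgroup.torsionBy.nsmul_iff]
  have h1 : Nat.card (T ⧸ DT) = Nat.card (T ⧸ DT)[(p : ℤ)] * Nat.card ψ.range := by
    rw [← hker, AddSubgroup.card_eq_card_quotient_mul_card_addSubgroup ψ.ker, mul_comm,
      Nat.card_congr (QuotientAddGroup.quotientKerEquivRange ψ).toEquiv]
  have h2 : Nat.card (T ⧸ DT) = Nat.card ((T ⧸ DT) ⧸ ψ.range) * Nat.card ψ.range :=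
    AddSubgroup.card_eq_card_quotient_mul_card_addSubgroup ψ.range
  have hpos : 0 < Nat.card ψ.range := Nat.card_pos
  exact Nat.eq_of_mul_eq_mul_right hpos (h2.symm.trans h1)

/-- **Evenness of `dim_{𝔽_p} T/pT`** for `T = A[p^∞]` under the hypotheses of
`exists_natCard_modN_primaryComponent_eq_pow_two_mul` (a torsion group with finite `p`-torsion and
an alternating pairing with kernel the divisible elements): `T/pT` is finite and its
`𝔽_p`-dimension is even. [cite: Dokchitser2013ParityNotes, §2 (first display)] -/
theorem even_finrank_modN_primaryComponent (hA : AddMonoid.IsTorsion A) [Finite A[(p : ℤ)]]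
    (B : A →+ A →+ AddCircle (1 : ℚ)) (halt : ∀ x, B x x = 0)
    (hrad : ∀ x, (∀ y, B x y = 0) ↔ ∀ n : ℕ, 0 < n → ∃ y, n • y = x) :
    Finite (ModN (AddCommGroup.primaryComponent A p) p) ∧
      Even (Module.finrank (ZMod p) (ModN (AddCommGroup.primaryComponent A p) p)) := by
  obtain ⟨m, hm⟩ := exists_natCard_modN_primaryComponent_eq_pow_two_mul (p := p) hA B halt hrad
  haveI : Finite (ModN (AddCommGroup.primaryComponent A p) p) :=
    Nat.finite_of_card_ne_zero (by rw [hm]; exact pow_ne_zero _ hp.out.ne_zero)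
  haveI : Module.Finite (ZMod p) (ModN (AddCommGroup.primaryComponent A p) p) :=
    Module.Finite.of_finite
  refine ⟨‹_›, m, ?_⟩
  have h := Module.natCard_eq_pow_finrank (K := ZMod p)
    (V := ModN (AddCommGroup.primaryComponent A p) p)
  rw [hm, Nat.card_zmod] at h
  have := Nat.pow_right_injective hp.out.two_le h
  omega

end Primary

end Literature.Algebra.Module

end
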